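/-
COR-CM (cell pub-hodgecm2, stage 2 of the Hodge ladder) — count-neutral KERNEL CENSUS TRANSPORT «the MARKMAN COLUMN», degree 12, type
`ℤ/6×ℤ/2` (`c = (3,0)`) — CLOSED intrinsic form from `Gal(K/ℚ) ≃* Multiplicative (ZMod 6 × ZMod 2)` (seat prover-pub-hodgecm2-b23-g34-0, binder prover b23, gen 34; own lane DEG12-MARKMAN-TRANSPORT,
HOME/LIT-CLAIMS.md l.1451, HOME/INBOX.md l.5632; seat b07's ORBIT-COUNT v2 §7.3/§7.4 offer by adjacency; sequel of
`Census/DuodecicFaceTransportC6C2.lean` (b23) on seat b09's DECIC-MARKMAN pattern `Census/DecicFaceTransportOfMarkman.lean`, generic part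
`CorCM/FaceCensusMarkmanColumn.lean`).  Theorems only; no definition, no named fact, nothing asserted; the census data `Γ` of
`Census/DuodecicFaceGeneratorsC6C2.lean` BY NAME; `Interfaces.lean` (C1), every E term, `B01/*`, `Transposition/*` untouched.
HONEST FRAMING (COORDINATOR RULING — HODGE FRAMING CORRECTION, 2026-08-21T11:55:35Z): `HC_CM` is NOT proved, here or anywhere in the
tree; nothing here produces a period or proves a case of the Hodge conjecture.
T5 (coordinator ruling 15:33:56Z (3)): binder set = that of `…_duodecicC6C2_of_markman_aut` with the automorphism dictionary DERIVED from
`e : Gal(K/ℚ) ≃* Multiplicative (ZMod 6 × ZMod 2)` (seat b23 gen 33's `exists_autEnum_of_mulEquiv`); one named fact (Markman); no contradiction derivable; checker: self, 2026-08-21.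
-/
import Summits.HodgeConjecture.CorCM.Census.DuodecicFaceTransportC6C2OfMarkmanClosed
import Summits.HodgeConjecture.CorCM.Census.DuodecicFaceTransportC6C2Intrinsic
import HarnessLib

/-!
# Degree 12, type `ℤ/6×ℤ/2` (`c = (3,0)`): 5 face periods + Markman's fourfold theorem, from `Gal(K/ℚ) ≃* Multiplicative (ZMod 6 × ZMod 2)` (CLOSED, intrinsic form)

Thin intrinsic wrapper of `Census/DuodecicFaceTransportC6C2OfMarkmanClosed.lean`: the automorphism dictionary `(σ₀, ε, hε, c, hc, hεc)` of
`…_duodecicC6C2_of_markman_aut` is produced from an isomorphism `e : Gal(K/ℚ) ≃* Multiplicative (ZMod 6 × ZMod 2)` by seat b23 gen 33's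
`DuodecicFaceTransport.C6C2.exists_autEnum_of_mulEquiv` (`Census/DuodecicFaceTransportC6C2Intrinsic.lean`), and the 5 faces are described by
group elements.  HEADLINE `…_duodecicC6C2_of_markman_mulEquiv`: ONE period witness on each of the 5 faces + Markman's fourfold theorem ⟹ the
Hodge conjecture, in every codimension, for every complex abelian variety dominated by a finite product of abelian varieties realising CM types
of CM fields embeddable in `K`.  (Seat b23's landed `…_duodecicC6C2_mulEquiv` needs 6 periods and no named fact.)  `HC_CM` is NOT proved;
no period is produced here.

References: [cite: Markman2025SurveySecant, Thm. 1.2]; [cite: Pohlmann1968, Thm. 1]; [cite: Milne1999LefschetzClasses, Thm. 3.2 and Cor. 4.5];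
[cite: Shimura1998, §6.2 Theorem 3 and §6.1 Corollary of Theorem 2 (pp. 41–43)]; [cite: MumfordAV1970, §19 Thm. 1 and p. 169].
-/

noncomputable section

open CategoryTheory NumberField NumberField.ComplexEmbedding
open Literature.AlgebraicGeometry Literature.AlgebraicGeometry.Motives Literature.AlgebraicGeometry.HodgeTheory
open Literature.AlgebraicGeometry.ComplexMultiplication Literature.AlgebraicGeometry.Milne1999
open Literature.NumberTheory.Automorphic Literature.NumberTheory.Automorphic.PicardCM
open Literature.NumberTheory.ComplexMultiplication.CMTypeOps
open Summit.HodgeConjecture.CorCM.Prior.AllgGroup.RfwfAllgGroup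
open Summit.HodgeConjecture.CorCM.Census.FaceSquaresModel
open Summit.HodgeConjecture.CorCM.Census.DuodecicFaceGeneratorsC6C2 (Γ)
open Summit.HodgeConjecture.CorCM.FaceCensus
open Summit.HodgeConjecture.CorCM.Domination

open Summit.HodgeConjecture.CorCM.DuodecicFaceTransport.C6C2 (exists_autEnum_of_mulEquiv)

namespace Summit.HodgeConjecture.CorCM.DuodecicFaceTransport.C6C2Markman

/-- **FIELD CLOSURE FROM `Gal(K/ℚ) ≃* Multiplicative (ZMod 6 × ZMod 2)` + Markman's fourfold theorem, type `ℤ/6×ℤ/2` (`c = (3,0)`) — CLOSED (intrinsic headline).**  `K` a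
Galois CM field with an isomorphism `e : Gal(K/ℚ) ≃* Multiplicative (ZMod 6 × ZMod 2)` normalised so that `e⁻¹(3,0)` induces complex conjugation at `σ₀` (always possible: `FaceCensus.exists_mulEquiv_conj_zmod_six_two`), a base
embedding `σ₀`, and 5 faces described through `e` (type = the listed group elements, place representatives `σ₀ ∘ e⁻¹(·)`); ONE period witness
on each + Markman's fourfold theorem ⟹ the Hodge conjecture, in every codimension, for every complex abelian variety dominated by a finite product of
abelian varieties realising CM types of CM fields embeddable in `K` (the automorphism dictionary is produced by
`DuodecicFaceTransport.C6C2.exists_autEnum_of_mulEquiv`, seat b23 gen 33).  (FRAMING: conditional on these 5 face periods and on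
Markman's UNREFEREED theorem; `HC_CM` is not proved.) [cite: Markman2025SurveySecant, Thm. 1.2] [cite: Shimura1998, §6.2 Theorem 3 and §6.1
Corollary of Theorem 2 (pp. 41–43)] [cite: Pohlmann1968, Thm. 1] [cite: Milne1999LefschetzClasses, Thm. 3.2 and Cor. 4.5]
[cite: MumfordAV1970, §19 Thm. 1 and p. 169] -/
theorem hodgeConjectureFor_of_avDominatedBy_isProductOf_of_facePeriods_duodecicC6C2_of_markman_mulEquiv
    (hW4 : Markman2025_weilClasses_algebraic_abelianFourfold) (K : CMField) [IsGalois ℚ K]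
    (e : ((K : Type) ≃ₐ[ℚ] (K : Type)) ≃* Multiplicative (ZMod 6 × ZMod 2)) (σ₀ : (K : Type) →+* ℂ)
    (hconj : σ₀.comp ((e.symm (Multiplicative.ofAdd ((3 : ZMod 6), (0 : ZMod 2))) : ((K : Type) ≃ₐ[ℚ] (K : Type))) : (K : Type) →+* (K : Type)) = conjugate σ₀) (R₁ R₂ R₃ R₄ R₅ : Face K)
    (hΦ₁ : ∀ h : ((K : Type) ≃ₐ[ℚ] (K : Type)), σ₀.comp (h : (K : Type) →+* (K : Type)) ∈ R₁.Φ.1 ↔ Multiplicative.toAdd (e h) ∈ ({((0 : ZMod 6), (0 : ZMod 2)), ((1 : ZMod 6), (0 : ZMod 2)), ((2 : ZMod 6), (0 : ZMod 2)), ((0 : ZMod 6), (1 : ZMod 2)), ((1 : ZMod 6), (1 : ZMod 2)), ((2 : ZMod 6), (1 : ZMod 2))} : Finset (ZMod 6 × ZMod 2)))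
    (hp₁ : R₁.p = σ₀.comp ((e.symm (Multiplicative.ofAdd (((0 : ZMod 6), (0 : ZMod 2)))) : ((K : Type) ≃ₐ[ℚ] (K : Type))) : (K : Type) →+* (K : Type)))
    (hq₁ : R₁.p' = σ₀.comp ((e.symm (Multiplicative.ofAdd (((1 : ZMod 6), (0 : ZMod 2)))) : ((K : Type) ≃ₐ[ℚ] (K : Type))) : (K : Type) →+* (K : Type)))
    (hΦ₂ : ∀ h : ((K : Type) ≃ₐ[ℚ] (K : Type)), σ₀.comp (h : (K : Type) →+* (K : Type)) ∈ R₂.Φ.1 ↔ Multiplicative.toAdd (e h) ∈ ({((0 : ZMod 6), (0 : ZMod 2)), ((1 : ZMod 6), (0 : ZMod 2)), ((2 : ZMod 6), (0 : ZMod 2)), ((0 : ZMod 6), (1 : ZMod 2)), ((1 : ZMod 6), (1 : ZMod 2)), ((2 : ZMod 6), (1 : ZMod 2))} : Finset (ZMod 6 × ZMod 2)))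
    (hp₂ : R₂.p = σ₀.comp ((e.symm (Multiplicative.ofAdd (((0 : ZMod 6), (0 : ZMod 2)))) : ((K : Type) ≃ₐ[ℚ] (K : Type))) : (K : Type) →+* (K : Type)))
    (hq₂ : R₂.p' = σ₀.comp ((e.symm (Multiplicative.ofAdd (((2 : ZMod 6), (0 : ZMod 2)))) : ((K : Type) ≃ₐ[ℚ] (K : Type))) : (K : Type) →+* (K : Type)))
    (hΦ₃ : ∀ h : ((K : Type) ≃ₐ[ℚ] (K : Type)), σ₀.comp (h : (K : Type) →+* (K : Type)) ∈ R₃.Φ.1 ↔ Multiplicative.toAdd (e h) ∈ ({((0 : ZMod 6), (0 : ZMod 2)), ((1 : ZMod 6), (0 : ZMod 2)), ((2 : ZMod 6), (0 : ZMod 2)), ((0 : ZMod 6), (1 : ZMod 2)), ((1 : ZMod 6), (1 : ZMod 2)), ((2 : ZMod 6), (1 : ZMod 2))} : Finset (ZMod 6 × ZMod 2)))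
    (hp₃ : R₃.p = σ₀.comp ((e.symm (Multiplicative.ofAdd (((0 : ZMod 6), (0 : ZMod 2)))) : ((K : Type) ≃ₐ[ℚ] (K : Type))) : (K : Type) →+* (K : Type)))
    (hq₃ : R₃.p' = σ₀.comp ((e.symm (Multiplicative.ofAdd (((1 : ZMod 6), (1 : ZMod 2)))) : ((K : Type) ≃ₐ[ℚ] (K : Type))) : (K : Type) →+* (K : Type)))
    (hΦ₄ : ∀ h : ((K : Type) ≃ₐ[ℚ] (K : Type)), σ₀.comp (h : (K : Type) →+* (K : Type)) ∈ R₄.Φ.1 ↔ Multiplicative.toAdd (e h) ∈ ({((1 : ZMod 6), (0 : ZMod 2)), ((2 : ZMod 6), (0 : ZMod 2)), ((3 : ZMod 6), (0 : ZMod 2)), ((0 : ZMod 6), (1 : ZMod 2)), ((1 : ZMod 6), (1 : ZMod 2)), ((2 : ZMod 6), (1 : ZMod 2))} : Finset (ZMod 6 × ZMod 2)))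
    (hp₄ : R₄.p = σ₀.comp ((e.symm (Multiplicative.ofAdd (((1 : ZMod 6), (0 : ZMod 2)))) : ((K : Type) ≃ₐ[ℚ] (K : Type))) : (K : Type) →+* (K : Type)))
    (hq₄ : R₄.p' = σ₀.comp ((e.symm (Multiplicative.ofAdd (((2 : ZMod 6), (1 : ZMod 2)))) : ((K : Type) ≃ₐ[ℚ] (K : Type))) : (K : Type) →+* (K : Type)))
    (hΦ₅ : ∀ h : ((K : Type) ≃ₐ[ℚ] (K : Type)), σ₀.comp (h : (K : Type) →+* (K : Type)) ∈ R₅.Φ.1 ↔ Multiplicative.toAdd (e h) ∈ ({((1 : ZMod 6), (0 : ZMod 2)), ((2 : ZMod 6), (0 : ZMod 2)), ((3 : ZMod 6), (0 : ZMod 2)), ((0 : ZMod 6), (1 : ZMod 2)), ((1 : ZMod 6), (1 : ZMod 2)), ((2 : ZMod 6), (1 : ZMod 2))} : Finset (ZMod 6 × ZMod 2)))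
    (hp₅ : R₅.p = σ₀.comp ((e.symm (Multiplicative.ofAdd (((2 : ZMod 6), (0 : ZMod 2)))) : ((K : Type) ≃ₐ[ℚ] (K : Type))) : (K : Type) →+* (K : Type)))
    (hq₅ : R₅.p' = σ₀.comp ((e.symm (Multiplicative.ofAdd (((1 : ZMod 6), (1 : ZMod 2)))) : ((K : Type) ≃ₐ[ℚ] (K : Type))) : (K : Type) →+* (K : Type)))
    (h₁ : ∃ ι₁ : K →+* ℂ, R₁.Admissible ι₁ ∧ ∃ (V : HermSpace3 K ι₁) (σ : K →+* ℂ),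
      (Model.picardCMUniverse exists_isReal_hodgeModel_holds hodgePQ_independent_of_hodgeModel_holds
        BallQuotient.ballQuotientUniformised_holds cmAbelianVarietyRealised_holds).PeriodNV ι₁ V K R₁.psi σ)
    (h₂ : ∃ ι₁ : K →+* ℂ, R₂.Admissible ι₁ ∧ ∃ (V : HermSpace3 K ι₁) (σ : K →+* ℂ),
      (Model.picardCMUniverse exists_isReal_hodgeModel_holds hodgePQ_independent_of_hodgeModel_holds
        BallQuotient.ballQuotientUniformised_holds cmAbelianVarietyRealised_holds).PeriodNV ι₁ V K R₂.psi σ)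
    (h₃ : ∃ ι₁ : K →+* ℂ, R₃.Admissible ι₁ ∧ ∃ (V : HermSpace3 K ι₁) (σ : K →+* ℂ),
      (Model.picardCMUniverse exists_isReal_hodgeModel_holds hodgePQ_independent_of_hodgeModel_holds
        BallQuotient.ballQuotientUniformised_holds cmAbelianVarietyRealised_holds).PeriodNV ι₁ V K R₃.psi σ)
    (h₄ : ∃ ι₁ : K →+* ℂ, R₄.Admissible ι₁ ∧ ∃ (V : HermSpace3 K ι₁) (σ : K →+* ℂ),
      (Model.picardCMUniverse exists_isReal_hodgeModel_holds hodgePQ_independent_of_hodgeModel_holds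
        BallQuotient.ballQuotientUniformised_holds cmAbelianVarietyRealised_holds).PeriodNV ι₁ V K R₄.psi σ)
    (h₅ : ∃ ι₁ : K →+* ℂ, R₅.Admissible ι₁ ∧ ∃ (V : HermSpace3 K ι₁) (σ : K →+* ℂ),
      (Model.picardCMUniverse exists_isReal_hodgeModel_holds hodgePQ_independent_of_hodgeModel_holds
        BallQuotient.ballQuotientUniformised_holds cmAbelianVarietyRealised_holds).PeriodNV ι₁ V K R₅.psi σ)
    {P A : AbelianVariety ℂ} (hP : AbelianVariety.IsProductOf (fun B : AbelianVariety ℂ =>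
      ∃ (E : Type) (_ : Field E) (_ : NumberField E) (_ : IsCMField E) (_ : E →+* (K : Type)) (Φ : CMType E)
        (ι : 𝓞 E →+* End B) (θ : E →+* Module.End ℂ (complexBetti B.X 1)),
        IsCMTypeRealisation Φ B ι θ) P)
    (hA : AVDominatedBy A P) : HodgeConjectureFor A.dim A.X := by
  obtain ⟨ε, hε, hread, hidx, hεc⟩ := exists_autEnum_of_mulEquiv K e
  refine hodgeConjectureFor_of_avDominatedBy_isProductOf_of_facePeriods_duodecicC6C2_of_markman_aut hW4 K σ₀ ε hε _ hconj hεc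
    R₁ R₂ R₃ R₄ R₅
    (e.symm (Multiplicative.ofAdd (((0 : ZMod 6), (0 : ZMod 2))))) (e.symm (Multiplicative.ofAdd (((1 : ZMod 6), (0 : ZMod 2)))))
    (e.symm (Multiplicative.ofAdd (((0 : ZMod 6), (0 : ZMod 2))))) (e.symm (Multiplicative.ofAdd (((2 : ZMod 6), (0 : ZMod 2)))))
    (e.symm (Multiplicative.ofAdd (((0 : ZMod 6), (0 : ZMod 2))))) (e.symm (Multiplicative.ofAdd (((1 : ZMod 6), (1 : ZMod 2)))))
    (e.symm (Multiplicative.ofAdd (((1 : ZMod 6), (0 : ZMod 2))))) (e.symm (Multiplicative.ofAdd (((2 : ZMod 6), (1 : ZMod 2)))))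
    (e.symm (Multiplicative.ofAdd (((2 : ZMod 6), (0 : ZMod 2))))) (e.symm (Multiplicative.ofAdd (((1 : ZMod 6), (1 : ZMod 2)))))
    ?_ ?_ ?_ ?_ ?_ ?_ ?_ ?_ ?_ ?_ ?_ ?_ ?_ ?_ ?_ ?_ ?_ ?_ ?_ ?_ ?_ ?_ ?_ ?_ ?_ h₁ h₂ h₃ h₄ h₅ hP hA
  · intro h
    rw [hΦ₁, ← hread h]
    exact (Summit.HodgeConjecture.CorCM.DuodecicFaceTransport.C6C2.mem_455_iff_enum (ε h)).symm
  · exact hp₁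
  · rw [hidx _ 0 (by rw [MulEquiv.apply_symm_apply, toAdd_ofAdd]; decide)]; decide
  · exact hq₁
  · rw [hidx _ 1 (by rw [MulEquiv.apply_symm_apply, toAdd_ofAdd]; decide)]; decide
  · intro h
    rw [hΦ₂, ← hread h]
    exact (Summit.HodgeConjecture.CorCM.DuodecicFaceTransport.C6C2.mem_455_iff_enum (ε h)).symm
  · exact hp₂
  · rw [hidx _ 0 (by rw [MulEquiv.apply_symm_apply, toAdd_ofAdd]; decide)]; decide
  · exact hq₂
  · rw [hidx _ 2 (by rw [MulEquiv.apply_symm_apply, toAdd_ofAdd]; decide)]; decide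
  · intro h
    rw [hΦ₃, ← hread h]
    exact (Summit.HodgeConjecture.CorCM.DuodecicFaceTransport.C6C2.mem_455_iff_enum (ε h)).symm
  · exact hp₃
  · rw [hidx _ 0 (by rw [MulEquiv.apply_symm_apply, toAdd_ofAdd]; decide)]; decide
  · exact hq₃
  · rw [hidx _ 7 (by rw [MulEquiv.apply_symm_apply, toAdd_ofAdd]; decide)]; decide
  · intro h
    rw [hΦ₄, ← hread h]
    exact (Summit.HodgeConjecture.CorCM.DuodecicFaceTransport.C6C2.mem_462_iff_enum (ε h)).symm
  · exact hp₄
  · rw [hidx _ 1 (by rw [MulEquiv.apply_symm_apply, toAdd_ofAdd]; decide)]; decide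
  · exact hq₄
  · rw [hidx _ 8 (by rw [MulEquiv.apply_symm_apply, toAdd_ofAdd]; decide)]; decide
  · intro h
    rw [hΦ₅, ← hread h]
    exact (Summit.HodgeConjecture.CorCM.DuodecicFaceTransport.C6C2.mem_462_iff_enum (ε h)).symm
  · exact hp₅
  · rw [hidx _ 2 (by rw [MulEquiv.apply_symm_apply, toAdd_ofAdd]; decide)]; decide
  · exact hq₅
  · rw [hidx _ 7 (by rw [MulEquiv.apply_symm_apply, toAdd_ofAdd]; decide)]; decide

end Summit.HodgeConjecture.CorCM.DuodecicFaceTransport.C6C2Markman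

end
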